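import Literature.Analysis.FluidPDE.CompressibleEulerPrimitiveForm
import Literature.Analysis.FluidPDE.CompressibleEulerImplosion
import Literature.Analysis.FunctionSpaces.TorusChainRule
import Summits.AtomisticToContinuum.HydrodynamicLimit.Theorems.ImplosionDichotomyPolynomialCompressionUniquenessEnergy
import Summits.AtomisticToContinuum.HydrodynamicLimit.Theorems.ImplosionDichotomyPolynomialCompressionIdealGasBridge

/-!
# Isentropic data stay isentropic (ideal monatomic gas), and the bridge back to the isentropic system

Helper file for the support item `TypeOneIdealImplosion` (stmt-AtomisticToContinuum-15146) of the
route `ImplosionDichotomy` (`AtomisticToContinuum/HydrodynamicLimit`). The exterior part of the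
periodic Type-I implosion is produced by the local existence theorem for the COMPLETE Euler system
of the monatomic ideal gas (`p = ρϑ`, `e = 3ϑ/2`; the named fact
`Literature.Analysis.FluidPDE.CompressibleEulerLocalWellPosedness` with `ζ ≡ 1`), launched from
ISENTROPIC data `ϑ₀ = K ρ₀^{2/3}`. This file proves that the classical solution stays isentropic
and is then a classical solution of the isentropic system in the sense of
`Literature.Analysis.FluidPDE.IsIsentropicEulerSolution (5/3)`:

* `isentropic_of_isentropic_data` — for a classical solution of the complete ideal-gas system on
  `[0, T) × 𝕋³` with `ϑ(0) = K ρ(0)^{2/3}`, `ϑ = K ρ^{2/3}` on `[0, T)`. Proof: in primitive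
  variables (`CompressibleEulerPrimitiveForm`) the specific-entropy variable `k = ϑ ρ^{−2/3}` is
  transported, `∂ₜk + u·∇k = 0` (continuity + temperature equations), so `e = (k − K)²` obeys
  `∂ₜe + div(e u) = (div u) e ≤ C e` on compact time slabs, `e(0) = 0`, and the Grönwall shell on
  `𝕋³` (`torus_energy_eq_zero_of_balance`) gives `e ≡ 0`;
* `isIsentropicEulerSolution_of_ideal_isentropic` — a classical ideal-gas solution with
  `ϑ = (3/5)ρ^{2/3}` solves the isentropic system with `γ = 5/3` (`p = ρϑ = ρ^{5/3}/(5/3)`;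
  the primitive Euler equation multiplied by `ρ`).

Folklore (Courant–Friedrichs, *Supersonic Flow and Shock Waves*, §§3, 7: for smooth flows the
entropy is constant along particle paths; isentropic data give isentropic flow).
-/

noncomputable section

namespace Summit.AtomisticToContinuum.HydrodynamicLimit.Theorems

open Set Filter Topology MeasureTheory Function
open scoped ContDiff
open Literature.MathematicalPhysics.KineticTheory
open Literature.Analysis.FunctionSpaces Literature.Analysis.FunctionSpaces.Torus
open Literature.Analysis.FluidPDE (IsIsentropicEulerSolution)
open Literature.Analysis.FluidPDE.CompressibleEuler (EulerEOS IsClassicalEulerSolution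
  IsPrimitiveEulerSolutionOn)

variable {T K : ℝ} {f : ℝ → ℝ} {ρ θ : ℝ → T3 → ℝ} {u : ℝ → T3 → V3}

/-! ## The entropy variable `k = ϑ ρ^{-2/3}` is transported -/

/-- The function `g(a, b) = b a^{-2/3}` is smooth on `(0, ∞) × ℝ`. [folklore] -/
theorem contDiffOn_entropyVar :
    ContDiffOn ℝ ∞ (uncurry fun a b : ℝ => b * a ^ (-(2 / 3) : ℝ)) (Ioi 0 ×ˢ univ) := by
  refine contDiffOn_snd.mul (contDiffOn_fst.rpow_const_of_ne fun p hp => ?_)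
  exact (ne_of_gt (mem_prod.1 hp).1)

/-- Slice derivatives of `g(a, b) = b a^{-2/3}`: `∂_a g = −(2/3) b a^{-5/3}`, `∂_b g = a^{-2/3}`
(`a > 0`). [folklore] -/
theorem deriv_entropyVar {a b : ℝ} (ha : 0 < a) :
    deriv (fun a' : ℝ => b * a' ^ (-(2 / 3) : ℝ)) a = -(2 / 3) * b * a ^ (-(5 / 3) : ℝ) ∧
      deriv (fun b' : ℝ => b' * a ^ (-(2 / 3) : ℝ)) b = a ^ (-(2 / 3) : ℝ) := by
  constructor
  · have h := ((Real.hasDerivAt_rpow_const (p := -(2 / 3)) (Or.inl ha.ne')).const_mul b).deriv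
    rw [h, show (-(2 / 3) - 1 : ℝ) = -(5 / 3) by norm_num]
    ring
  · rw [deriv_mul_const_field, deriv_id'', one_mul]

/-- **Transport of the entropy variable.** For a classical solution of the complete system of the
monatomic ideal gas (`monatomicExcess 1 f`: `p = ρϑ`, `e = 3ϑ/2`) on `[0, T) × 𝕋³`, the variable
`k = ϑ ρ^{-2/3}` satisfies `∂ₜk + ∑ᵢ uᵢ ∂ᵢk = 0` pointwise (`∂ₜρ + u·∇ρ = −ρ div u`,
`∂ₜϑ + u·∇ϑ = −(2/3)ϑ div u`). [folklore] -/
theorem entropyVar_transport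
    (h : IsClassicalEulerSolution (EulerEOS.monatomicExcess (fun _ => (1 : ℝ)) f) T ρ u θ)
    {t : ℝ} (ht : t ∈ Ico 0 T) (x : T3) :
    timeDerivWithin (Ico 0 T) (fun s y => θ s y * ρ s y ^ (-(2 / 3) : ℝ)) t x +
      ∑ i, u t x i * partialDeriv i (fun y => θ t y * ρ t y ^ (-(2 / 3) : ℝ)) x = 0 := by
  have hprim := h.primitive_monatomicExcess (ζ := fun _ => (1 : ℝ)) (f := f) contDiff_const
  have hU : UniqueDiffOn ℝ (Ico (0 : ℝ) T) := uniqueDiffOn_Ico 0 T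
  have hρ := hprim.smooth_density
  have hθ := hprim.smooth_temperature
  have hρt : 0 < ρ t x := hprim.density_pos t ht x
  have hmem : (ρ t x, θ t x) ∈ Ioi (0 : ℝ) ×ˢ (univ : Set ℝ) := ⟨hρt, mem_univ _⟩
  have hopen : IsOpen (Ioi (0 : ℝ) ×ˢ (univ : Set ℝ)) := isOpen_Ioi.prod isOpen_univ
  obtain ⟨hda, hdb⟩ := deriv_entropyVar (b := θ t x) hρt
  -- chain rules
  have hT := timeDerivWithin_comp₂ (g := fun a b : ℝ => b * a ^ (-(2 / 3) : ℝ)) contDiffOn_entropyVar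
    hopen (by simp) hρ hθ hU ht x hmem
  have hX : ∀ i : Fin 3, partialDeriv i (fun y => θ t y * ρ t y ^ (-(2 / 3) : ℝ)) x =
      deriv (fun a' : ℝ => θ t x * a' ^ (-(2 / 3) : ℝ)) (ρ t x) * partialDeriv i (ρ t) x +
        deriv (fun b' : ℝ => b' * ρ t x ^ (-(2 / 3) : ℝ)) (θ t x) * partialDeriv i (θ t) x :=
    fun i => partialDeriv_comp₂ (g := fun a b : ℝ => b * a ^ (-(2 / 3) : ℝ)) contDiffOn_entropyVar
      hopen (by simp) ((hρ.isSmooth_slice ht).of_le (mod_cast le_top))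
      ((hθ.isSmooth_slice ht).of_le (mod_cast le_top)) x hmem i
  have hc := hprim.continuity t ht x
  have hte := hprim.temperature_eq hU ht x
  simp only [mul_one] at hte
  rw [show (fun s y => θ s y * ρ s y ^ (-(2 / 3) : ℝ)) =
      fun s y => (fun a b : ℝ => b * a ^ (-(2 / 3) : ℝ)) (ρ s y) (θ s y) from rfl, hT]
  simp_rw [hX, hda, hdb]
  -- algebra: collect the two transport residuals
  have hρ53 : ρ t x ^ (-(5 / 3) : ℝ) * ρ t x = ρ t x ^ (-(2 / 3) : ℝ) := by
    rw [← Real.rpow_add_one hρt.ne']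
    norm_num
  have key : -(2 / 3) * θ t x * ρ t x ^ (-(5 / 3) : ℝ) * timeDerivWithin (Ico 0 T) ρ t x +
        ρ t x ^ (-(2 / 3) : ℝ) * timeDerivWithin (Ico 0 T) θ t x +
      ∑ i, u t x i * (-(2 / 3) * θ t x * ρ t x ^ (-(5 / 3) : ℝ) * partialDeriv i (ρ t) x +
        ρ t x ^ (-(2 / 3) : ℝ) * partialDeriv i (θ t) x) =
      -(2 / 3) * θ t x * ρ t x ^ (-(5 / 3) : ℝ) *
          (timeDerivWithin (Ico 0 T) ρ t x + (∑ i, u t x i * partialDeriv i (ρ t) x) +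
            ρ t x * divergence (u t) x) +
        ρ t x ^ (-(2 / 3) : ℝ) *
          (timeDerivWithin (Ico 0 T) θ t x + (∑ i, u t x i * partialDeriv i (θ t) x) +
            2 / 3 * θ t x * divergence (u t) x) := by
    have e1 : ∑ i, u t x i * (-(2 / 3) * θ t x * ρ t x ^ (-(5 / 3) : ℝ) * partialDeriv i (ρ t) x +
        ρ t x ^ (-(2 / 3) : ℝ) * partialDeriv i (θ t) x) =
        -(2 / 3) * θ t x * ρ t x ^ (-(5 / 3) : ℝ) * ∑ i, u t x i * partialDeriv i (ρ t) x +
          ρ t x ^ (-(2 / 3) : ℝ) * ∑ i, u t x i * partialDeriv i (θ t) x := by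
      rw [Finset.mul_sum, Finset.mul_sum, ← Finset.sum_add_distrib]
      refine Finset.sum_congr rfl fun i _ => by ring
    rw [e1]
    have e2 : -(2 / 3) * θ t x * ρ t x ^ (-(5 / 3) : ℝ) * (ρ t x * divergence (u t) x) +
        ρ t x ^ (-(2 / 3) : ℝ) * (2 / 3 * θ t x * divergence (u t) x) = 0 := by
      rw [← hρ53]; ring
    linear_combination -e2
  rw [key, hc, hte, mul_zero, mul_zero, add_zero]

/-! ## Isentropic data stay isentropic -/

/-- **Isentropic data stay isentropic** (smooth flows of the monatomic ideal gas). Let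
`(ρ, u, ϑ)` be a classical solution of the complete Euler system with `p = ρϑ`, `e = 3ϑ/2` on
`[0, T) × 𝕋³` whose data satisfy `ϑ(0, ·) = K ρ(0, ·)^{2/3}`. Then `ϑ = K ρ^{2/3}` on
`[0, T) × 𝕋³`. Proof: `k = ϑρ^{−2/3}` is transported (`entropyVar_transport`), so for
`e = (k − K)²`, `Φᵢ = uᵢ e` one has `∂ₜe + ∑ᵢ∂ᵢΦᵢ = (div u) e ≤ C e` on `[0, t₁] × 𝕋³`,
`e(0) = 0`, and the energy method on `𝕋³` (`torus_energy_eq_zero_of_balance`) forces `e ≡ 0`.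
[folklore] -/
theorem isentropic_of_isentropic_data
    (h : IsClassicalEulerSolution (EulerEOS.monatomicExcess (fun _ => (1 : ℝ)) f) T ρ u θ)
    (h0 : ∀ x, θ 0 x = K * ρ 0 x ^ (2 / 3 : ℝ)) :
    ∀ t ∈ Ico 0 T, ∀ x, θ t x = K * ρ t x ^ (2 / 3 : ℝ) := by
  rcases le_or_gt T 0 with hT | hT
  · intro t ht
    exact absurd (ht.1.trans_lt ht.2) (not_lt.2 hT)
  have hprim := h.primitive_monatomicExcess (ζ := fun _ => (1 : ℝ)) (f := f) contDiff_const
  have hU : UniqueDiffOn ℝ (Ico (0 : ℝ) T) := uniqueDiffOn_Ico 0 T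
  have hρ := hprim.smooth_density
  have hθ := hprim.smooth_temperature
  have hu := hprim.smooth_velocity
  -- the entropy variable and its smoothness
  set k : ℝ → T3 → ℝ := fun s y => θ s y * ρ s y ^ (-(2 / 3) : ℝ) with hk
  have hks : IsSmoothSpaceTimeOn (Ico 0 T) k := by
    have hg : ContDiffOn ℝ ∞ (uncurry fun a b : ℝ => b * a ^ (-(2 / 3) : ℝ)) (Ioi 0 ×ˢ Ioi 0) :=
      contDiffOn_entropyVar.mono (prod_mono le_rfl (subset_univ _))
    exact Literature.Analysis.FluidPDE.CompressibleEuler.isSmoothSpaceTimeOn_comp_quadrant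
      (g := fun a b : ℝ => b * a ^ (-(2 / 3) : ℝ)) (ρ := ρ) (ϑ := θ) hg hρ hθ
      hprim.density_pos hprim.temperature_pos
  -- the energy and the fluxes
  set e : ℝ → T3 → ℝ := fun s y => (k s y - K) ^ 2 with he
  set Φ : Fin 3 → ℝ → T3 → ℝ := fun i s y => u s y i * (k s y - K) ^ 2 with hΦ
  have hKc : IsSmoothSpaceTimeOn (Ico 0 T) (fun (_ : ℝ) (_ : T3) => K) :=
    isSmoothSpaceTimeOn_const (g := fun _ : T3 => K) contDiff_const _
  have hkK : IsSmoothSpaceTimeOn (Ico 0 T) (fun s y => k s y - K) := hks.sub hKc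
  have hes : IsSmoothSpaceTimeOn (Ico 0 T) e := by
    have h2 := hkK.mul hkK
    refine h2.congr fun p _ => ?_
    simp only [stLift, he, sq]
  have hΦs : ∀ i, IsSmoothSpaceTimeOn (Ico 0 T) (Φ i) := fun i => (hu.apply i).mul hes
  -- transport of `k` in the form needed below
  have htr : ∀ t ∈ Ico 0 T, ∀ x, timeDerivWithin (Ico 0 T) k t x +
      ∑ i, u t x i * partialDeriv i (k t) x = 0 := fun t ht x => entropyVar_transport h ht x
  -- the balance `∂ₜe + Σᵢ ∂ᵢΦᵢ = (div u) e`
  have hbal_eq : ∀ t ∈ Ico 0 T, ∀ x, timeDerivWithin (Ico 0 T) e t x + ∑ i, partialDeriv i (Φ i t) x =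
      divergence (u t) x * e t x := by
    intro t ht x
    have hk1 : IsContDiff 1 (k t) := (hks.isSmooth_slice ht).of_le (mod_cast le_top)
    have hu1 : ∀ i, IsContDiff 1 (fun y => u t y i) := fun i =>
      ((hu.apply i).isSmooth_slice ht).of_le (mod_cast le_top)
    have he1 : IsContDiff 1 (e t) := (hes.isSmooth_slice ht).of_le (mod_cast le_top)
    -- `∂ₜe = 2(k − K) ∂ₜk`
    have hφ : ∀ z : ℝ, HasDerivAt (fun w : ℝ => (w - K) ^ 2) (2 * (z - K)) z := fun z => by
      have h1 := ((hasDerivAt_id z).sub_const K).pow 2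
      refine HasDerivAt.congr_deriv (f := fun w : ℝ => (w - K) ^ 2) h1 ?_
      simp
    have hte : timeDerivWithin (Ico 0 T) e t x = 2 * (k t x - K) * timeDerivWithin (Ico 0 T) k t x := by
      have h1 := (hφ (k t x)).comp_hasDerivWithinAt t (hks.hasDerivWithinAt_slice ht x)
      exact h1.derivWithin (hU t ht)
    -- `∂ᵢe = 2(k − K) ∂ᵢk`, `∂ᵢΦᵢ = uᵢ ∂ᵢe + ∂ᵢuᵢ e`
    have hxe : ∀ i, partialDeriv i (e t) x = 2 * (k t x - K) * partialDeriv i (k t) x := fun i =>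
      partialDeriv_comp_of_hasDerivAt hk1 x (hφ (k t x)) i
    have hxΦ : ∀ i, partialDeriv i (Φ i t) x =
        u t x i * partialDeriv i (e t) x + partialDeriv i (fun y => u t y i) x * e t x := fun i =>
      partialDeriv_mul (hu1 i) he1 i x
    rw [hte, Finset.sum_congr rfl fun i _ => hxΦ i]
    simp_rw [hxe]
    have hsplit : ∑ i, (u t x i * (2 * (k t x - K) * partialDeriv i (k t) x) +
        partialDeriv i (fun y => u t y i) x * e t x) =
        2 * (k t x - K) * ∑ i, u t x i * partialDeriv i (k t) x + divergence (u t) x * e t x := by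
      rw [Finset.sum_add_distrib, Finset.mul_sum, divergence, Finset.sum_mul]
      congr 1
      exact Finset.sum_congr rfl fun i _ => by ring
    rw [hsplit]
    have h0 := htr t ht x
    linear_combination 2 * (k t x - K) * h0
  -- apply the Grönwall shell
  have hzero := torus_energy_eq_zero_of_balance (T := T) (e := e) (Φ := Φ) hes hΦs
    (fun t _ x => sq_nonneg _)
    (fun x => by
      have hρ0 : 0 < ρ 0 x := hprim.density_pos 0 ⟨le_rfl, hT⟩ x
      have hk0 : k 0 x = K := by
        show θ 0 x * ρ 0 x ^ (-(2 / 3) : ℝ) = K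
        rw [h0 x, mul_assoc, ← Real.rpow_add hρ0]
        norm_num
      show (k 0 x - K) ^ 2 = 0
      rw [hk0, sub_self, zero_pow two_ne_zero])
    (fun t₁ ht₁ => by
      obtain ⟨C, -, hC⟩ := exists_abs_le_of_isSmoothSpaceTimeOn (hu.divergence hU) ht₁.2
      refine ⟨C, fun t ht x => ?_⟩
      have htI : t ∈ Ico 0 T := ⟨ht.1, ht.2.trans_lt ht₁.2⟩
      rw [hbal_eq t htI x]
      exact mul_le_mul_of_nonneg_right ((le_abs_self _).trans (hC t ht x)) (sq_nonneg _))
  intro t ht x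
  have h1 : e t x = 0 := hzero t ht x
  have h2 : k t x = K := by
    have : (k t x - K) ^ 2 = 0 := h1
    nlinarith [sq_nonneg (k t x - K)]
  have hρt : 0 < ρ t x := hprim.density_pos t ht x
  have h3 : θ t x * ρ t x ^ (-(2 / 3) : ℝ) = K := h2
  calc θ t x = θ t x * ρ t x ^ (-(2 / 3) : ℝ) * ρ t x ^ (2 / 3 : ℝ) := by
        rw [mul_assoc, ← Real.rpow_add hρt]; norm_num
    _ = K * ρ t x ^ (2 / 3 : ℝ) := by rw [h3]

/-! ## Back to the isentropic system -/

/-- **A classical ideal-gas solution with `ϑ = (3/5)ρ^{2/3}` is a classical isentropic solution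
with `γ = 5/3`.** The pressure is `p = ρϑ = (3/5)ρ^{5/3} = ρ^{5/3}/(5/3)`, and the primitive Euler
equation `∂ₜu + ∑ᵢuᵢ∂ᵢu + ρ⁻¹∇p = 0` (`CompressibleEulerPrimitiveForm`) multiplied by `ρ` is the
non-conservative momentum equation of `IsIsentropicEulerSolution`. (Converse of the tree's bridge
`isHardSphereEulerSolution_zero_of_isentropic`.) [folklore] -/
theorem isIsentropicEulerSolution_of_ideal_isentropic
    (h : IsClassicalEulerSolution (EulerEOS.monatomicExcess (fun _ => (1 : ℝ)) f) T ρ u θ)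
    (hθ : ∀ t ∈ Ico 0 T, ∀ x, θ t x = 3 / 5 * ρ t x ^ (2 / 3 : ℝ)) :
    IsIsentropicEulerSolution (5 / 3) T ρ u where
  smooth_density := h.smooth_density
  smooth_velocity := h.smooth_velocity
  density_pos := h.density_pos
  mass := h.mass
  momentum t ht x := by
    have hprim := h.primitive_monatomicExcess (ζ := fun _ => (1 : ℝ)) (f := f) contDiff_const
    have he := hprim.euler t ht x
    have hp : (fun y => (EulerEOS.monatomicExcess (fun _ => (1 : ℝ)) f).p (ρ t y) (θ t y)) =
        fun y => ρ t y ^ (5 / 3 : ℝ) / (5 / 3) := by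
      funext y
      show ρ t y * θ t y * 1 = _
      rw [hθ t ht y, rpow_five_thirds (h.density_pos t ht y)]
      ring
    rw [hp] at he
    have hρ := h.density_pos t ht x
    have h2 := congrArg (fun v => ρ t x • v) he
    simp only [smul_add, smul_smul, mul_inv_cancel₀ hρ.ne', one_smul, smul_zero] at h2
    exact h2

end Summit.AtomisticToContinuum.HydrodynamicLimit.Theorems

end
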